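import Summits.QuantumFields.YangMills.Theorems.BalabanUVNodesN16HolderConst
import Summits.QuantumFields.YangMills.Theorems.BalabanUVNodesN16Thm4Print
import HarnessLib

/-!
# Route «BalabanUVNodes», cluster K4 «SpineRates» — node N16 = NE3: THE (OUT) ∕ (OUT₁₃₈) ∕ (OUT_print) ∕ (T4ᵀ_print) KNITS AT HÖLDER EXPONENT `β` —
# n16-a's `n16_of_thm4Output` ∕ `n16_of_thm4OutputLandau138` ∕ `n16_of_thm4OutputPrint` ∕ `n16_of_thm4TorusAt_print` with the (1.36) Hölder member of the
# N05-side hypothesis at its PRINTED exponent and the β-root `CovRootHolder` as conclusion, ONE `(r, C)` for every `β ≤ 1`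

Cell `pub-ymgap`, seat `pub-ymgap-dag-n16-c` (R134 fan-out seat, strategy s1; HUMAN RULING D-0062; chair R424 venue), generation 3, file 13 — module (C) of
the producer column of repair R-β of the located item «the Hölder-exponent pin of N16's N05-socket» (`HOME/pub-ymgap-dag-n16-c/LOCATED-N16-HOLDER-PIN.md`;
pub-ymgap INBOX DAGN16C-G3-INTENT-1); over file 12 `…N16HolderConst` (`n16_holder_constant_of_record`) and n16-a's files 7, 9, 11, 12, 13 (`…N16Thm4Output`
p…, `…N16Thm4OutputLandau138` p424658, `…N16PrintLetters` p428632, `…N16Thm4OutputPrint` p430904, `…N16Thm4Print` p431368) whose per-pair producers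
`pairLandauGaugeB8Avg_of_thm4Output`, `thm4Output_of_thm4OutputLandau138`, `thm4OutputLandau138_of_thm4OutputPrint` (`β ≤ 1`), `thm4OutputPrint_of_thm4TorusAt_print`
are β-GENERIC BY NAME.  `--supports stmt-QuantumFields-19908` (helper).  `bears_on: R4∕N16 · edge N05 → N16`.

WHY.  Each of n16-a's four knits reads the Hölder line of its N05-side binder at `β₀ = 1` (`ξ^{(2:ℝ)+1}` ∕ `ξ^{(1:ℝ)}`), which [Balaban1985RegularSpaces] excludes
(«β ≦ β₀ < 1», p. 82).  THIS FILE is the same four theorems with `1 ↦ β` — statements VERBATIM but for the Hölder line (`^((2:ℝ)+β)` ∕ `^β`), the binder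
`∀ (s₂ β : ℝ)` (resp. `∀ ⦃β⦄, β ≤ 1 →` where print's letters are converted), and the conclusion `CovRootHolder 4 (sfClass 4 L N ε) L N b g C s₁ s₂ β dom`; proofs =
the originals' letter bookkeeping token for token over file 12 and the β-generic producers.  `β := 1` returns the theorems of record (`N16HolderDefs.covRootHolder_one_iff`).

WHAT THIS FILE PROVES (kernel, theorems only, 0 `def`, 0 sorry): §1 `n16_holder_of_thm4Output` ((OUT) at `(s₁, g′, s₂, β)`) · §2 `n16_holder_of_thm4OutputLandau138`
((OUT₁₃₈)) · §3 `n16_holder_of_thm4OutputPrint` ((OUT_print), `β ≤ 1`) · §4 `n16_holder_of_thm4TorusAt_print` ((T4ᵀ_print) = print's [B8] Theorem 4 in the all-torus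
geometry with the CONCRETE conclusion slot at exponent `β`, `β ≤ 1`).
HONEST FRAMING: binder bookkeeping over LANDED theorems by name; the N05-side binders ([Balaban1985RegularSpaces] Thm 4 + Prop 3 ∕ Thm 2 + (1.37) at the pair,
torus case) and N07's `LeafH3sup` ([Balaban1985Variational] Thm 1 (8)+(10) TYPE) are HYPOTHESES; nothing of Bałaban's proved; **N16 ∕ NE3 NOT discharged**; the
repair's statement edit is the planner's; count-neutral; one finite four-torus at fixed ε — NOT ℝ⁴, NOT infinite volume, NOT OS, NOT a mass gap, NOT Clay.
-/

set_option autoImplicit false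

open scoped BigOperators Matrix Matrix.Norms.L2Operator
open NormedSpace

namespace Summit.QuantumFields.YangMills.BalabanUVNodes.N16HolderOfThm4Output

open Literature.MathematicalPhysics.QuantumFieldTheory.Balaban1983to89
open B7Prop1Explicit B7Prop2Explicit
open T4AveragingDeficitWall (IsUnitaryCfg SmallField Ad IsSkewDir vary fineAction blockSites)
open T4AveragingDeficitWallBoundary (IsPeriodicCfg periodBox)
open B8Lemma1NonAbelian (pert)
open B7Eq92Concrete (mgauge)
open B8Ineq132 (covDerivFwd InAk)
open B8Eq146AExpansion (iEta)
open B8Eq184Proof (cfgExp)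
open B8Eq119TwistedAxial (Restr129)
open B8Eq166ConstraintPair (ptw)
open B8Eq133Hypotheses (Reg335Zd)
open B8Eq138LandauZd (covLap IsLandau138)
open B8Thm4TorusAt (torusLam Thm4TorusAt)
open Summit.QuantumFields.BalabanUV.T4Continuum
open AveragingDeficitPeriodicCounting (IsPeriodicDir)
open MinimalActionSandwich (IsMinimiser)
open MinimalActionRate (Regular sfClass)
open BlockAverageCurrent (curConst curConst_nonneg)
open NE3EnergyShapes (IsUnitarySite IsPeriodicSite)
open NE3RightInverseSupLetters (frameC)
open NE3.PairLandauB8 (LandauRepB8 IsLandauB8 covLapDir)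
open NE3.PairLandauB8Avg (PairLandauGaugeB8Avg)
open NE3.LeafIndexSockets (LeafH3sup)
open Summit.QuantumFields.YangMills.BalabanUVNodes.N16HolderDefs (CovRootHolder)
open Summit.QuantumFields.YangMills.BalabanUVNodes.N16HolderConst (n16_holder_constant_of_record)
open Summit.QuantumFields.YangMills.BalabanUVNodes.N16 (restrRegime_of_small pairLandauGaugeB8Avg_of_thm4Output thm4Output_of_thm4OutputLandau138
  thm4OutputLandau138_of_thm4OutputPrint thm4OutputPrint_of_thm4TorusAt_print)

noncomputable section

variable {n : Type*} [Fintype n] [DecidableEq n]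

/-! ## §1 (OUT) at exponent `β` -/

/-- **N16 · THE β-ROOT FROM [B8] THM 4's OUTPUT AT THE PAIR (HÖLDER MEMBER AT EXPONENT `β`) AND N07's INTERFACE** (`d = 4`; `L ≥ 2`, `N ≥ 1`) — n16-a's
`N16.n16_of_thm4Output` with `1 ↦ β`: the displayed absolute letter `α₁ = min {1∕(3C₀(4)), c₂′(4,L)∕2}`; `∃ r > 0, ∀ g > 0, ∃ C ≥ 0` (functions of `(L, N, n[, g])`
ONLY), then for all leaf letters on the three ε-free lines, `0 < ε ≤ r`, `0 ≤ s₁ ≤ r`, `0 ≤ b ≤ ε∕2`, the gradient letter `g′`, every `s₂`, EVERY `β` and `dom`: (OUT) at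
`(s₁, g′, s₂, β)` → `LeafH3sup 4 L N ε b′ c′ dom` → `CovRootHolder 4 (sfClass 4 L N ε) L N b g C s₁ s₂ β dom`.  File 12's `n16_holder_constant_of_record` ∘
`N16.pairLandauGaugeB8Avg_of_thm4Output` (β-generic).  N16 ∕ NE3 NOT proved: (OUT) and (H3ˢᵘᵖ) are the hypotheses. [folklore] -/
theorem n16_holder_of_thm4Output [Nonempty n] {L N : ℕ} (hL : 2 ≤ L) (hN : 1 ≤ N) :
    ∃ r : ℝ, 0 < r ∧ ∀ ⦃g : ℝ⦄, 0 < g → ∃ C : ℝ, 0 ≤ C ∧ ∀ ⦃b' c' : ℝ⦄, 0 ≤ b' → 0 ≤ c' →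
      2 ^ 15 * ((4 : ℝ) + 1) ^ 2 * ((4 : ℝ) + 4) ^ 2 * (L : ℝ) ^ 2 * b' ≤ 1 →
      23040 * (4 : ℝ) ^ 4 * (frameC 4 L + 4) ^ 3 * (c' + curConst 4 L * b' ^ 2) ≤ 1 →
      b' + 226 * (8 * ((4 : ℝ) + 1) * ((4 : ℝ) + 4)) ^ 2 * b' ^ 2 < min (1 / (3 * C0 4)) (c2' 4 L / 2) →
      ∀ ⦃ε s₁ b : ℝ⦄, 0 < ε → ε ≤ r → 0 ≤ s₁ → s₁ ≤ r → 0 ≤ b → b ≤ ε / 2 →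
      ∀ ⦃g' : ℝ⦄, g' + 2 * (b' + 226 * (8 * ((4 : ℝ) + 1) * ((4 : ℝ) + 4)) ^ 2 * b' ^ 2) * s₁ ≤ s₁ → ∀ (s₂ β : ℝ)
      {dom : _root_.Set (Site 4 → Fin 4 → (Matrix n n ℂ)ˣ)},
        (∀ k : ℕ, 1 ≤ k → ∀ V ∈ dom, ∀ UA UB : Site 4 → Fin 4 → (Matrix n n ℂ)ˣ,
          IsMinimiser 4 (sfClass 4 L N ε) L N k V UA → IsMinimiser 4 (sfClass 4 L N ε) L N (k + 1) V UB → Regular 4 L N b g (k + 1) UB →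
          ∃ u : Site 4 → (Matrix n n ℂ)ˣ, (∀ x, u x ∈ unitaryUnits (Matrix n n ℂ)) ∧ IsPeriodicSite u ((N * L ^ k : ℕ) : ℤ) ∧
            (∃ Λ : ℕ → Set (Site 4), Λ k = Set.univ ∧ Restr129 L k Λ (rescale L (bavg L UB)) u) ∧
            ∃ A : Site 4 → Fin 4 → Matrix n n ℂ,
              (∀ x μ, IsSelfAdjoint (A x μ)) ∧ (∀ (x : Site 4) (κ μ : Fin 4), A (x + ((N * L ^ k : ℕ) : ℤ) • e κ) μ = A x μ) ∧
              mgauge (rescale L (bavg L UB)) u (cfgExp (((L : ℝ) ^ k)⁻¹) A)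
                = pert (gaugeAct (ptw L (rescale L (bavg L UB)) UA k) UA) (rescale L (bavg L UB)) ∧
              (∀ x μ, ‖A x μ‖ ≤ s₁) ∧
              (∀ (μ : Fin 4) (x : Site 4) (κ : Fin 4), ‖covDerivFwd (((L : ℝ) ^ k)⁻¹) (rescale L (bavg L UB)) μ (fun z => A z κ) x‖ ≤ g') ∧
              IsLandauB8 L N k (rescale L (bavg L UB)) (fun x μ => Ad (rescale L (bavg L UB) x μ)⁻¹ (iEta (((L : ℝ) ^ k)⁻¹) A x μ)) ∧
              (∀ (κ μ : Fin 4) (y : Site 4),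
                ‖Ad (rescale L (bavg L UB) (y + e κ) μ)
                    (Ad (rescale L (bavg L UB) (y + e κ + e μ) μ)
                        ((fun x μ => Ad (rescale L (bavg L UB) x μ)⁻¹ (iEta (((L : ℝ) ^ k)⁻¹) A x μ)) (y + (2 : ℕ) • e μ) κ)
                      - (fun x μ => Ad (rescale L (bavg L UB) x μ)⁻¹ (iEta (((L : ℝ) ^ k)⁻¹) A x μ)) (y + e μ) κ)
                  - (Ad (rescale L (bavg L UB) (y + e κ) μ)
                      ((fun x μ => Ad (rescale L (bavg L UB) x μ)⁻¹ (iEta (((L : ℝ) ^ k)⁻¹) A x μ)) (y + e μ) κ)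
                    - (fun x μ => Ad (rescale L (bavg L UB) x μ)⁻¹ (iEta (((L : ℝ) ^ k)⁻¹) A x μ)) y κ)‖
                  ≤ s₂ * (((L : ℝ)⁻¹) ^ k) ^ ((2 : ℝ) + β)) ∧
              (∀ (x : Site 4) (κ : Fin 4),
                ‖covLapDir (rescale L (bavg L UB)) (fun x μ => Ad (rescale L (bavg L UB) x μ)⁻¹ (iEta (((L : ℝ) ^ k)⁻¹) A x μ)) x κ‖
                  ≤ s₁ * (((L : ℝ)⁻¹) ^ k) ^ 3)) →
        LeafH3sup 4 L N ε b' c' dom →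
        CovRootHolder 4 (sfClass 4 L N ε) L N b g C s₁ s₂ β dom := by
  have hL1 : 1 ≤ L := by omega
  obtain ⟨r, hr0, hr⟩ := n16_holder_constant_of_record (n := n) hL hN
  -- the displayed absolute letter `α₁` (pinned axial pre-gauge's regime)
  set α : ℝ := min (1 / (3 * C0 4)) (c2' 4 L / 2) with hαdef
  have hC0 : 0 < C0 4 := C0_pos 4
  have hc2 : 0 < c2' 4 L := c2'_pos 4 L hL1
  have hα0 : 0 < α := lt_min (by positivity) (by positivity)
  have hα1 : α ≤ 1 / (3 * C0 4) := min_le_left _ _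
  have hα2' : α ≤ c2' 4 L / 2 := min_le_right _ _
  -- file 2's four radii at `d = 4`
  obtain ⟨R₁, hR₁⟩ : ∃ R : ℝ, R = 1 / (6 * C0 4 + 1) := ⟨_, rfl⟩
  obtain ⟨R₃, hR₃⟩ : ∃ R : ℝ, R = 1 / (226 * (8 * ((4 : ℝ) + 1) * ((4 : ℝ) + 4)) ^ 2 + 1) := ⟨_, rfl⟩
  obtain ⟨R₄, hR₄⟩ : ∃ R : ℝ, R = 1 / (256 * ((4 : ℝ) + 1) * ((4 : ℝ) + 4) * (L : ℝ) ^ 2 + 1) := ⟨_, rfl⟩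
  have hR₁0 : 0 < R₁ := by rw [hR₁]; positivity
  have hR₃0 : 0 < R₃ := by rw [hR₃]; positivity
  have hR₄0 : 0 < R₄ := by rw [hR₄]; positivity
  refine ⟨min r (min (α / 2) (min R₁ (min (c2' 4 L / 4) (min R₃ R₄)))),
    lt_min hr0 (lt_min (by positivity) (lt_min hR₁0 (lt_min (by positivity) (lt_min hR₃0 hR₄0)))), fun g hg => ?_⟩
  obtain ⟨C, hC0', hC⟩ := hr hg
  refine ⟨C, hC0', fun b' c' hb' hc' hRb hcF hb'α ε s₁ b hε hεr hs₁ hs₁r hb hbh g' hgrad s₂ β dom hOut h3 => ?_⟩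
  have hεr' : ε ≤ r := hεr.trans (min_le_left _ _)
  have hεα2 : ε ≤ α / 2 := hεr.trans ((min_le_right _ _).trans (min_le_left _ _))
  have hε1 : ε ≤ R₁ := hεr.trans ((min_le_right _ _).trans ((min_le_right _ _).trans (min_le_left _ _)))
  have hε2 : ε ≤ c2' 4 L / 4 := hεr.trans ((min_le_right _ _).trans ((min_le_right _ _).trans ((min_le_right _ _).trans (min_le_left _ _))))
  have hε3 : ε ≤ R₃ :=
    hεr.trans ((min_le_right _ _).trans ((min_le_right _ _).trans ((min_le_right _ _).trans ((min_le_right _ _).trans (min_le_left _ _)))))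
  have hε4 : ε ≤ R₄ :=
    hεr.trans ((min_le_right _ _).trans ((min_le_right _ _).trans ((min_le_right _ _).trans ((min_le_right _ _).trans (min_le_right _ _)))))
  have hs₁r' : s₁ ≤ r := hs₁r.trans (min_le_left _ _)
  have h1 : (6 * C0 4 + 1) * ε ≤ 1 := by
    rw [hR₁, le_div_iff₀ (by positivity)] at hε1; linarith
  have h2 : 4 * ε ≤ c2' 4 L := by linarith
  have h3' : (226 * (8 * (((4 : ℕ) : ℝ) + 1) * (((4 : ℕ) : ℝ) + 4)) ^ 2 + 1) * ε ≤ 1 := by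
    rw [hR₃, le_div_iff₀ (by positivity)] at hε3; push_cast; linarith
  have h4' : (256 * (((4 : ℕ) : ℝ) + 1) * (((4 : ℕ) : ℝ) + 4) * (L : ℝ) ^ 2 + 1) * ε ≤ 1 := by
    rw [hR₄, le_div_iff₀ (by positivity)] at hε4; push_cast; linarith
  -- the class letter `b` and the class radius against `α`
  obtain ⟨-, -, hbα2, -, -, hbs⟩ := restrRegime_of_small 4 L hε hb hbh h1 h2 h3' h4'
  have hεα : ε < α := by linarith
  have hbα : b + 226 * (8 * ((4 : ℕ) + 1 : ℝ) * ((4 : ℕ) + 4 : ℝ)) ^ 2 * b ^ 2 < α := by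
    have : b + 226 * (8 * ((4 : ℕ) + 1 : ℝ) * ((4 : ℕ) + 4 : ℝ)) ^ 2 * b ^ 2 < 2 * ε := by simpa using hbα2
    linarith
  have hA3 : C0 4 * α ≤ 1 / 3 := by
    rw [le_div_iff₀ (by positivity)] at hα1; linarith
  have hA2 : 2 * α ≤ c2' 4 L := by linarith
  have hRb' : 2 ^ 15 * ((((4 : ℕ) : ℝ)) + 1) ^ 2 * ((((4 : ℕ) : ℝ)) + 4) ^ 2 * (L : ℝ) ^ 2 * b' ≤ 1 := by simpa only [Nat.cast_ofNat] using hRb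
  have hb'α' : b' + 226 * (8 * ((4 : ℕ) + 1 : ℝ) * ((4 : ℕ) + 4 : ℝ)) ^ 2 * b' ^ 2 < α := by simpa using hb'α
  have hgrad' : g' + 2 * (b' + 226 * (8 * ((4 : ℕ) + 1 : ℝ) * ((4 : ℕ) + 4 : ℝ)) ^ 2 * b' ^ 2) * s₁ ≤ s₁ := by simpa using hgrad
  exact hC hb' hc' hRb hcF hε hεr' hs₁ hs₁r' hb hbh s₂ β
    (pairLandauGaugeB8Avg_of_thm4Output (by norm_num) hL hε.le hb hbs hbα hb' hRb' hb'α' hα0 hεα hA3 hA2 hs₁ le_rfl hgrad' hOut h3) h3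

/-! ## §2 (OUT₁₃₈) at exponent `β` -/

/-- **N16 · THE β-ROOT FROM [B8] THM 4's OUTPUT AT THE PAIR, LANDAU MEMBER IN NODE N05's LETTER (1.38), HÖLDER MEMBER AT EXPONENT `β`** (`d = 4`; `L ≥ 2`,
`N ≥ 1`) — n16-a's `N16.n16_of_thm4OutputLandau138` with `1 ↦ β` (letters as in §1): (OUT₁₃₈) at `(s₁, g′, s₂, β)` → `LeafH3sup 4 L N ε b′ c′ dom` →
`CovRootHolder 4 (sfClass 4 L N ε) L N b g C s₁ s₂ β dom`.  §1 ∘ `N16.thm4Output_of_thm4OutputLandau138` (β-generic).  N16 ∕ NE3 NOT proved. [folklore] -/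
theorem n16_holder_of_thm4OutputLandau138 [Nonempty n] {L N : ℕ} (hL : 2 ≤ L) (hN : 1 ≤ N) :
    ∃ r : ℝ, 0 < r ∧ ∀ ⦃g : ℝ⦄, 0 < g → ∃ C : ℝ, 0 ≤ C ∧ ∀ ⦃b' c' : ℝ⦄, 0 ≤ b' → 0 ≤ c' →
      2 ^ 15 * ((4 : ℝ) + 1) ^ 2 * ((4 : ℝ) + 4) ^ 2 * (L : ℝ) ^ 2 * b' ≤ 1 →
      23040 * (4 : ℝ) ^ 4 * (frameC 4 L + 4) ^ 3 * (c' + curConst 4 L * b' ^ 2) ≤ 1 →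
      b' + 226 * (8 * ((4 : ℝ) + 1) * ((4 : ℝ) + 4)) ^ 2 * b' ^ 2 < min (1 / (3 * C0 4)) (c2' 4 L / 2) →
      ∀ ⦃ε s₁ b : ℝ⦄, 0 < ε → ε ≤ r → 0 ≤ s₁ → s₁ ≤ r → 0 ≤ b → b ≤ ε / 2 →
      ∀ ⦃g' : ℝ⦄, g' + 2 * (b' + 226 * (8 * ((4 : ℝ) + 1) * ((4 : ℝ) + 4)) ^ 2 * b' ^ 2) * s₁ ≤ s₁ → ∀ (s₂ β : ℝ)
      {dom : _root_.Set (Site 4 → Fin 4 → (Matrix n n ℂ)ˣ)},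
        (∀ k : ℕ, 1 ≤ k → ∀ V ∈ dom, ∀ UA UB : Site 4 → Fin 4 → (Matrix n n ℂ)ˣ,
          IsMinimiser 4 (sfClass 4 L N ε) L N k V UA → IsMinimiser 4 (sfClass 4 L N ε) L N (k + 1) V UB → Regular 4 L N b g (k + 1) UB →
          ∃ u : Site 4 → (Matrix n n ℂ)ˣ, (∀ x, u x ∈ unitaryUnits (Matrix n n ℂ)) ∧ IsPeriodicSite u ((N * L ^ k : ℕ) : ℤ) ∧
            (∃ Λ : ℕ → Set (Site 4), Λ k = Set.univ ∧ Restr129 L k Λ (rescale L (bavg L UB)) u) ∧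
            ∃ A : Site 4 → Fin 4 → Matrix n n ℂ,
              (∀ x μ, IsSelfAdjoint (A x μ)) ∧ (∀ (x : Site 4) (κ μ : Fin 4), A (x + ((N * L ^ k : ℕ) : ℤ) • e κ) μ = A x μ) ∧
              mgauge (rescale L (bavg L UB)) u (cfgExp (((L : ℝ) ^ k)⁻¹) A)
                = pert (gaugeAct (ptw L (rescale L (bavg L UB)) UA k) UA) (rescale L (bavg L UB)) ∧
              (∀ x μ, ‖A x μ‖ ≤ s₁) ∧
              (∀ (μ : Fin 4) (x : Site 4) (κ : Fin 4), ‖covDerivFwd (((L : ℝ) ^ k)⁻¹) (rescale L (bavg L UB)) μ (fun z => A z κ) x‖ ≤ g') ∧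
              IsLandau138 L k (((L : ℝ) ^ k)⁻¹) Set.univ (torusLam k) (rescale L (bavg L UB)) A ∧
              (∀ (κ μ : Fin 4) (y : Site 4),
                ‖Ad (rescale L (bavg L UB) (y + e κ) μ)
                    (Ad (rescale L (bavg L UB) (y + e κ + e μ) μ)
                        ((fun x μ => Ad (rescale L (bavg L UB) x μ)⁻¹ (iEta (((L : ℝ) ^ k)⁻¹) A x μ)) (y + (2 : ℕ) • e μ) κ)
                      - (fun x μ => Ad (rescale L (bavg L UB) x μ)⁻¹ (iEta (((L : ℝ) ^ k)⁻¹) A x μ)) (y + e μ) κ)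
                  - (Ad (rescale L (bavg L UB) (y + e κ) μ)
                      ((fun x μ => Ad (rescale L (bavg L UB) x μ)⁻¹ (iEta (((L : ℝ) ^ k)⁻¹) A x μ)) (y + e μ) κ)
                    - (fun x μ => Ad (rescale L (bavg L UB) x μ)⁻¹ (iEta (((L : ℝ) ^ k)⁻¹) A x μ)) y κ)‖
                  ≤ s₂ * (((L : ℝ)⁻¹) ^ k) ^ ((2 : ℝ) + β)) ∧
              (∀ (x : Site 4) (κ : Fin 4),
                ‖covLapDir (rescale L (bavg L UB)) (fun x μ => Ad (rescale L (bavg L UB) x μ)⁻¹ (iEta (((L : ℝ) ^ k)⁻¹) A x μ)) x κ‖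
                  ≤ s₁ * (((L : ℝ)⁻¹) ^ k) ^ 3)) →
        LeafH3sup 4 L N ε b' c' dom →
        CovRootHolder 4 (sfClass 4 L N ε) L N b g C s₁ s₂ β dom := by
  have hL1 : 1 ≤ L := by omega
  obtain ⟨r, hr0, hr⟩ := n16_holder_of_thm4Output (n := n) hL hN
  -- the displayed absolute letter `α₁` (pinned axial pre-gauge's regime)
  set α : ℝ := min (1 / (3 * C0 4)) (c2' 4 L / 2) with hαdef
  have hC0 : 0 < C0 4 := C0_pos 4
  have hc2 : 0 < c2' 4 L := c2'_pos 4 L hL1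
  have hα0 : 0 < α := lt_min (by positivity) (by positivity)
  have hα1 : α ≤ 1 / (3 * C0 4) := min_le_left _ _
  have hα2' : α ≤ c2' 4 L / 2 := min_le_right _ _
  -- file 2's four radii at `d = 4`
  obtain ⟨R₁, hR₁⟩ : ∃ R : ℝ, R = 1 / (6 * C0 4 + 1) := ⟨_, rfl⟩
  obtain ⟨R₃, hR₃⟩ : ∃ R : ℝ, R = 1 / (226 * (8 * ((4 : ℝ) + 1) * ((4 : ℝ) + 4)) ^ 2 + 1) := ⟨_, rfl⟩
  obtain ⟨R₄, hR₄⟩ : ∃ R : ℝ, R = 1 / (256 * ((4 : ℝ) + 1) * ((4 : ℝ) + 4) * (L : ℝ) ^ 2 + 1) := ⟨_, rfl⟩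
  have hR₁0 : 0 < R₁ := by rw [hR₁]; positivity
  have hR₃0 : 0 < R₃ := by rw [hR₃]; positivity
  have hR₄0 : 0 < R₄ := by rw [hR₄]; positivity
  refine ⟨min r (min (α / 2) (min R₁ (min (c2' 4 L / 4) (min R₃ R₄)))),
    lt_min hr0 (lt_min (by positivity) (lt_min hR₁0 (lt_min (by positivity) (lt_min hR₃0 hR₄0)))), fun g hg => ?_⟩
  obtain ⟨C, hC0', hC⟩ := hr hg
  refine ⟨C, hC0', fun b' c' hb' hc' hRb hcF hb'α ε s₁ b hε hεr hs₁ hs₁r hb hbh g' hgrad s₂ β dom hOut h3 => ?_⟩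
  have hεr' : ε ≤ r := hεr.trans (min_le_left _ _)
  have hεα2 : ε ≤ α / 2 := hεr.trans ((min_le_right _ _).trans (min_le_left _ _))
  have hε1 : ε ≤ R₁ := hεr.trans ((min_le_right _ _).trans ((min_le_right _ _).trans (min_le_left _ _)))
  have hε2 : ε ≤ c2' 4 L / 4 := hεr.trans ((min_le_right _ _).trans ((min_le_right _ _).trans ((min_le_right _ _).trans (min_le_left _ _))))
  have hε3 : ε ≤ R₃ :=
    hεr.trans ((min_le_right _ _).trans ((min_le_right _ _).trans ((min_le_right _ _).trans ((min_le_right _ _).trans (min_le_left _ _)))))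
  have hε4 : ε ≤ R₄ :=
    hεr.trans ((min_le_right _ _).trans ((min_le_right _ _).trans ((min_le_right _ _).trans ((min_le_right _ _).trans (min_le_right _ _)))))
  have hs₁r' : s₁ ≤ r := hs₁r.trans (min_le_left _ _)
  have h1 : (6 * C0 4 + 1) * ε ≤ 1 := by
    rw [hR₁, le_div_iff₀ (by positivity)] at hε1; linarith
  have h2 : 4 * ε ≤ c2' 4 L := by linarith
  have h3' : (226 * (8 * (((4 : ℕ) : ℝ) + 1) * (((4 : ℕ) : ℝ) + 4)) ^ 2 + 1) * ε ≤ 1 := by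
    rw [hR₃, le_div_iff₀ (by positivity)] at hε3; push_cast; linarith
  have h4' : (256 * (((4 : ℕ) : ℝ) + 1) * (((4 : ℕ) : ℝ) + 4) * (L : ℝ) ^ 2 + 1) * ε ≤ 1 := by
    rw [hR₄, le_div_iff₀ (by positivity)] at hε4; push_cast; linarith
  -- the class letter `b` against `α₁`
  obtain ⟨-, -, hbα2, -, -, hbs⟩ := restrRegime_of_small 4 L hε hb hbh h1 h2 h3' h4'
  have hbα : b + 226 * (8 * ((4 : ℕ) + 1 : ℝ) * ((4 : ℕ) + 4 : ℝ)) ^ 2 * b ^ 2 < α := by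
    have : b + 226 * (8 * ((4 : ℕ) + 1 : ℝ) * ((4 : ℕ) + 4 : ℝ)) ^ 2 * b ^ 2 < 2 * ε := by simpa using hbα2
    linarith
  have hA3 : C0 4 * α ≤ 1 / 3 := by
    rw [le_div_iff₀ (by positivity)] at hα1; linarith
  have hA2 : 2 * α ≤ c2' 4 L := by linarith
  exact hC hb' hc' hRb hcF hb'α hε hεr' hs₁ hs₁r' hb hbh hgrad s₂ β (thm4Output_of_thm4OutputLandau138 hL hN hb hbs hbα hα0 hA3 hA2 hOut) h3

/-! ## §3 (OUT_print) at exponent `β ≤ 1` -/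

/-- **N16 · THE β-ROOT FROM [B8] THM 4's OUTPUT AT THE PAIR IN PRINT's LETTERS (HÖLDER LINE `hol·ξ^{kβ}`, `β ≤ 1`) AND N07's INTERFACE** (`d = 4`; `L ≥ 2`,
`N ≥ 1`) — n16-a's `N16.n16_of_thm4OutputPrint` with `1 ↦ β`: the four k-free letter lines verbatim, then `∀ β ≤ 1, ∀ dom`: (OUT_print) at `(s, g′, hol, ℓ, β)` →
`LeafH3sup 4 L N ε b′ c′ dom` → `CovRootHolder 4 (sfClass 4 L N ε) L N b g C s₁ s₂ β dom`.  §2 ∘ `N16.thm4OutputLandau138_of_thm4OutputPrint` (`β ≤ 1`: `η³ ≤ η^{2+β}`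
converts print's (1.36) letters).  N16 ∕ NE3 NOT proved. [folklore] -/
theorem n16_holder_of_thm4OutputPrint [Nonempty n] {L N : ℕ} (hL : 2 ≤ L) (hN : 1 ≤ N) :
    ∃ r : ℝ, 0 < r ∧ ∀ ⦃g : ℝ⦄, 0 < g → ∃ C : ℝ, 0 ≤ C ∧ ∀ ⦃b' c' : ℝ⦄, 0 ≤ b' → 0 ≤ c' →
      2 ^ 15 * ((4 : ℝ) + 1) ^ 2 * ((4 : ℝ) + 4) ^ 2 * (L : ℝ) ^ 2 * b' ≤ 1 →
      23040 * (4 : ℝ) ^ 4 * (frameC 4 L + 4) ^ 3 * (c' + curConst 4 L * b' ^ 2) ≤ 1 →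
      b' + 226 * (8 * ((4 : ℝ) + 1) * ((4 : ℝ) + 4)) ^ 2 * b' ^ 2 < min (1 / (3 * C0 4)) (c2' 4 L / 2) →
      ∀ ⦃ε s₁ b : ℝ⦄, 0 < ε → ε ≤ r → 0 ≤ s₁ → s₁ ≤ r → 0 ≤ b → b ≤ ε / 2 →
      ∀ ⦃s g' hol ℓ s₂ : ℝ⦄, s ≤ s₁ → g' + 2 * (b' + 226 * (8 * ((4 : ℝ) + 1) * ((4 : ℝ) + 4)) ^ 2 * b' ^ 2) * s₁ ≤ s₁ →
      ℓ + 16 * (b' + 226 * (8 * ((4 : ℝ) + 1) * ((4 : ℝ) + 4)) ^ 2 * b' ^ 2) * s ≤ s₁ → hol + 8 * (b' + 226 * (8 * ((4 : ℝ) + 1) * ((4 : ℝ) + 4)) ^ 2 * b' ^ 2) * s ≤ s₂ →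
      ∀ ⦃β : ℝ⦄, β ≤ 1 → ∀ {dom : _root_.Set (Site 4 → Fin 4 → (Matrix n n ℂ)ˣ)},
        (
        ∀ k : ℕ, 1 ≤ k → ∀ V ∈ dom, ∀ UA UB : Site 4 → Fin 4 → (Matrix n n ℂ)ˣ,
          IsMinimiser 4 (sfClass 4 L N ε) L N k V UA → IsMinimiser 4 (sfClass 4 L N ε) L N (k + 1) V UB → Regular 4 L N b g (k + 1) UB →
          ∃ u : Site 4 → (Matrix n n ℂ)ˣ, (∀ x, u x ∈ unitaryUnits (Matrix n n ℂ)) ∧ IsPeriodicSite u (((N * L ^ k : ℕ) : ℤ)) ∧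
            (∃ Λ : ℕ → Set (Site 4), Λ k = Set.univ ∧ Restr129 L k Λ (rescale L (bavg L UB)) u) ∧
            ∃ A : Site 4 → Fin 4 → Matrix n n ℂ,
              (∀ x μ, IsSelfAdjoint (A x μ)) ∧ (∀ (x : Site 4) (κ μ : Fin 4), A (x + (((N * L ^ k : ℕ) : ℤ)) • e κ) μ = A x μ) ∧
              mgauge (rescale L (bavg L UB)) u (cfgExp (((L : ℝ) ^ k)⁻¹) A)
                = pert (gaugeAct (ptw L (rescale L (bavg L UB)) UA k) UA) (rescale L (bavg L UB)) ∧
              (∀ x μ, ‖A x μ‖ ≤ s) ∧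
              (∀ (μ : Fin 4) (x : Site 4) (κ : Fin 4), ‖covDerivFwd (((L : ℝ) ^ k)⁻¹) (rescale L (bavg L UB)) μ (fun z => A z κ) x‖ ≤ g') ∧
              IsLandau138 L k (((L : ℝ) ^ k)⁻¹) Set.univ (torusLam k) (rescale L (bavg L UB)) A ∧
              (∀ (μ : Fin 4) (y : Site 4) (κ : Fin 4),
                ‖Ad (rescale L (bavg L UB) y μ) (covDerivFwd (((L : ℝ) ^ k)⁻¹) (rescale L (bavg L UB)) μ (fun z => A z κ) (y + e μ)) - covDerivFwd (((L : ℝ) ^ k)⁻¹) (rescale L (bavg L UB)) μ (fun z => A z κ) y‖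
                  ≤ hol * (((L : ℝ)⁻¹) ^ k) ^ β) ∧
              (∀ (x : Site 4) (κ : Fin 4), ‖covLap (((L : ℝ) ^ k)⁻¹) (rescale L (bavg L UB)) (fun z => A z κ) x‖ ≤ ℓ)) →
        LeafH3sup 4 L N ε b' c' dom →
        CovRootHolder 4 (sfClass 4 L N ε) L N b g C s₁ s₂ β dom := by
  obtain ⟨r, hr0, hr⟩ := n16_holder_of_thm4OutputLandau138 (n := n) hL hN
  refine ⟨r, hr0, fun g hg => ?_⟩
  obtain ⟨C, hC0, hC⟩ := hr hg
  refine ⟨C, hC0, fun b' c' hb' hc' hRb hcF hb'α ε s₁ b hε hεr hs₁ hs₁r hb hbh s g' hol ℓ s₂ hss hgrad hℓ hhol β hβ dom hOut h3 => ?_⟩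
  have hbs' : 512 * (((4 : ℕ) : ℝ) + 1) * (((4 : ℕ) : ℝ) + 4) * (L : ℝ) ^ 2 * b' ≤ 1 := by
    have h0 : 0 ≤ (L : ℝ) ^ 2 * b' := by positivity
    push_cast; nlinarith only [h0, hRb]
  have hℓ' : ℓ + 4 * ((4 : ℕ) : ℝ) * (b' + 226 * (8 * (((4 : ℕ) : ℝ) + 1) * (((4 : ℕ) : ℝ) + 4)) ^ 2 * b' ^ 2) * s ≤ s₁ := by
    push_cast; linarith only [hℓ]
  have hhol' : hol + 8 * (b' + 226 * (8 * (((4 : ℕ) : ℝ) + 1) * (((4 : ℕ) : ℝ) + 4)) ^ 2 * b' ^ 2) * s ≤ s₂ := by push_cast; linarith only [hhol]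
  exact hC hb' hc' hRb hcF hb'α hε hεr hs₁ hs₁r hb hbh hgrad s₂ β
    (thm4OutputLandau138_of_thm4OutputPrint hL hb' hbs' hβ hss hhol' hℓ' hOut h3) h3

/-! ## §4 Print's Theorem 4 (all-torus geometry, concrete conclusion slot) at exponent `β ≤ 1` -/

/-- **N16 · THE β-ROOT FROM [B8] THEOREM 4 (ALL-TORUS GEOMETRY, CONCLUSION IN PRINT's LETTERS WITH THE (1.36) HÖLDER MEMBER AT EXPONENT `β ≤ 1`) AND N07's
INTERFACE — NO DICTIONARY BINDER** (`d = 4`; `L ≥ 2`, `N ≥ 1`; Thm 4's constants `c₁`, `B`, `B_h`) — n16-a's `N16.n16_of_thm4TorusAt_print` with `1 ↦ β`: the averaging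
letter `α` in its displayed window, the (3.35) schedule, the four k-free letter lines, then `∀ β ≤ 1`: (T4ᵀ_print)_β `∀ k ≥ 1, Thm4TorusAt L k (N·Lᵏ) (Lᵏ)⁻¹ c₁ unitaryUnits
(Reg335Zd …) (Restr129 L k (torusLam k)) Concl_print(B, B_h; β)` → `∀ dom, LeafH3sup 4 L N ε b′ c′ dom → CovRootHolder 4 (sfClass 4 L N ε) L N b g C s₁ s₂ β dom`.
§2 ∘ `N16.thm4OutputLandau138_of_thm4OutputPrint` ∘ `N16.thm4OutputPrint_of_thm4TorusAt_print`.  N16 ∕ NE3 NOT proved: (T4ᵀ_print)_β — [Balaban1985RegularSpaces]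
Thm 4 + Prop 3 at curved backgrounds, torus case, Hölder member as PRINTED — and (H3ˢᵘᵖ) are the hypotheses. [folklore] -/
theorem n16_holder_of_thm4TorusAt_print [Nonempty n] {L N : ℕ} (hL : 2 ≤ L) (hN : 1 ≤ N) :
    ∃ r : ℝ, 0 < r ∧ ∀ ⦃g : ℝ⦄, 0 < g → ∃ C : ℝ, 0 ≤ C ∧ ∀ (c₁ B Bh : ℝ) ⦃b' c' : ℝ⦄, 0 ≤ b' → 0 ≤ c' →
      2 ^ 15 * ((4 : ℝ) + 1) ^ 2 * ((4 : ℝ) + 4) ^ 2 * (L : ℝ) ^ 2 * b' ≤ 1 →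
      23040 * (4 : ℝ) ^ 4 * (frameC 4 L + 4) ^ 3 * (c' + curConst 4 L * b' ^ 2) ≤ 1 →
      ∀ ⦃α : ℝ⦄, 0 < α → C0 4 * α ≤ 1 / 3 → 2 * α ≤ c2' 4 L → 11 * (4 : ℝ) ^ 2 * α ≤ 1 / 6 → α + 11 * (4 : ℝ) ^ 2 * α ≤ c₁ →
      b' + 226 * (8 * ((4 : ℝ) + 1) * ((4 : ℝ) + 4)) ^ 2 * b' ^ 2 < α → 4 * ((4 : ℝ) - 1) * (c' + curConst 4 L * b' ^ 2) < α →
      ∀ ⦃Mc : ℝ⦄, 0 ≤ Mc → (Mc + 1) * (b' + 226 * (8 * ((4 : ℝ) + 1) * ((4 : ℝ) + 4)) ^ 2 * b' ^ 2) ≤ 1 / 2 →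
      ∀ (𝒬 : ℕ → Set (Set (Site 4) × ℕ)), (∀ k, ∀ q ∈ 𝒬 k, q.2 ≤ k ∧ ∃ y : Site 4, ∀ z ∈ q.1, (l1 (z - y) : ℝ) ≤ Mc * (L : ℝ) ^ q.2) →
      ∀ ⦃C335 : ℝ⦄, 2 * (Mc + 1) * (b' + 226 * (8 * ((4 : ℝ) + 1) * ((4 : ℝ) + 4)) ^ 2 * b' ^ 2) + 2 * Mc * (2 * (c' + curConst 4 L * b' ^ 2)) +
        4 * Mc * (1 + 2 * Mc) * (b' + 226 * (8 * ((4 : ℝ) + 1) * ((4 : ℝ) + 4)) ^ 2 * b' ^ 2) ^ 2 < C335 →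
      ∀ ⦃ε s₁ b s₂ : ℝ⦄, 0 < ε → ε ≤ r → ε < α → 0 ≤ s₁ → s₁ ≤ r → 0 ≤ b → b ≤ ε / 2 →
      B * (α + 11 * (4 : ℝ) ^ 2 * α) ≤ s₁ →
      B * (α + 11 * (4 : ℝ) ^ 2 * α) + 2 * (b' + 226 * (8 * ((4 : ℝ) + 1) * ((4 : ℝ) + 4)) ^ 2 * b' ^ 2) * s₁ ≤ s₁ →
      B * (α + 11 * (4 : ℝ) ^ 2 * α) + 16 * (b' + 226 * (8 * ((4 : ℝ) + 1) * ((4 : ℝ) + 4)) ^ 2 * b' ^ 2) * (B * (α + 11 * (4 : ℝ) ^ 2 * α)) ≤ s₁ →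
      Bh * (α + 11 * (4 : ℝ) ^ 2 * α) + 8 * (b' + 226 * (8 * ((4 : ℝ) + 1) * ((4 : ℝ) + 4)) ^ 2 * b' ^ 2) * (B * (α + 11 * (4 : ℝ) ^ 2 * α)) ≤ s₂ → ∀ ⦃β : ℝ⦄, β ≤ 1 →
      (∀ k, 1 ≤ k → Thm4TorusAt L k (((N * L ^ k : ℕ) : ℤ)) (((L : ℝ) ^ k)⁻¹) c₁ (unitaryUnits (Matrix n n ℂ))
        (Reg335Zd (((L : ℝ) ^ k)⁻¹) L (𝒬 k) C335) (Restr129 L k (torusLam k))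
        (fun (α₀ α₁ : ℝ) (U₀ U' : Site 4 → Fin 4 → (Matrix n n ℂ)ˣ) (u : Site 4 → (Matrix n n ℂ)ˣ) =>
          ∃ A : Site 4 → Fin 4 → Matrix n n ℂ,
            (∀ x μ, IsSelfAdjoint (A x μ)) ∧ (∀ (x : Site 4) (κ μ : Fin 4), A (x + (((N * L ^ k : ℕ) : ℤ)) • e κ) μ = A x μ) ∧
            mgauge U₀ u (cfgExp (((L : ℝ) ^ k)⁻¹) A) = U' ∧
            (∀ x μ, ‖A x μ‖ ≤ B * (α₀ + α₁)) ∧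
            (∀ (μ : Fin 4) (x : Site 4) (κ : Fin 4), ‖covDerivFwd (((L : ℝ) ^ k)⁻¹) U₀ μ (fun z => A z κ) x‖ ≤ B * (α₀ + α₁)) ∧
            IsLandau138 L k (((L : ℝ) ^ k)⁻¹) Set.univ (torusLam k) U₀ A ∧
            (∀ (μ : Fin 4) (y : Site 4) (κ : Fin 4),
              ‖Ad (U₀ y μ) (covDerivFwd (((L : ℝ) ^ k)⁻¹) U₀ μ (fun z => A z κ) (y + e μ)) - covDerivFwd (((L : ℝ) ^ k)⁻¹) U₀ μ (fun z => A z κ) y‖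
                ≤ Bh * (α₀ + α₁) * (((L : ℝ)⁻¹) ^ k) ^ β) ∧
            (∀ (x : Site 4) (κ : Fin 4), ‖covLap (((L : ℝ) ^ k)⁻¹) U₀ (fun z => A z κ) x‖ ≤ B * (α₀ + α₁)))) →
      ∀ {dom : _root_.Set (Site 4 → Fin 4 → (Matrix n n ℂ)ˣ)},
        LeafH3sup 4 L N ε b' c' dom →
        CovRootHolder 4 (sfClass 4 L N ε) L N b g C s₁ s₂ β dom := by
  have hL1 : 1 ≤ L := by omega
  obtain ⟨r, hr0, hr⟩ := n16_holder_of_thm4OutputLandau138 (n := n) hL hN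
  refine ⟨r, hr0, fun g hg => ?_⟩
  obtain ⟨C, hC0, hC⟩ := hr hg
  refine ⟨C, hC0, fun c₁ B Bh b' c' hb' hc' hRb hcF α hα hA3 hA2 hAs hAc hb'α hc'α Mc hMc hMcα 𝒬 h𝒬 C335 hC335 ε s₁ b s₂ hε hεr hεα hs₁ hs₁r hb hbh
    hss hgrad hℓ hhol β hβ hT4 dom h3 => ?_⟩
  have hC0' : 0 < C0 4 := C0_pos 4
  -- `α` sits below file 7's displayed `α₁`
  have hα1 : α ≤ 1 / (3 * C0 4) := by rw [le_div_iff₀ (by positivity)]; linarith only [hA3]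
  have hb'α₁ : b' + 226 * (8 * ((4 : ℝ) + 1) * ((4 : ℝ) + 4)) ^ 2 * b' ^ 2 < min (1 / (3 * C0 4)) (c2' 4 L / 2) :=
    lt_of_lt_of_le hb'α (le_min hα1 (by linarith only [hA2]))
  -- the sup letters' lines, cast to §2's shapes
  have hL1r : (1 : ℝ) ≤ L := by exact_mod_cast hL1
  have hb'1 : b' ≤ 1 := by
    have hL2 : (1 : ℝ) ≤ (L : ℝ) ^ 2 := one_le_pow₀ hL1r
    nlinarith only [hL2, hRb, hb']
  have hbs' : 512 * (((4 : ℕ) : ℝ) + 1) * (((4 : ℕ) : ℝ) + 4) * (L : ℝ) ^ 2 * b' ≤ 1 := by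
    have h0 : 0 ≤ (L : ℝ) ^ 2 * b' := by positivity
    push_cast; nlinarith only [h0, hRb]
  have hRb' : 2 ^ 15 * ((((4 : ℕ) : ℝ)) + 1) ^ 2 * ((((4 : ℕ) : ℝ)) + 4) ^ 2 * (L : ℝ) ^ 2 * b' ≤ 1 := by simpa only [Nat.cast_ofNat] using hRb
  have hb'α' : b' + 226 * (8 * ((4 : ℕ) + 1 : ℝ) * ((4 : ℕ) + 4 : ℝ)) ^ 2 * b' ^ 2 < α := by simpa using hb'α
  have hc'α' : 4 * ((((4 : ℕ) : ℝ)) - 1) * (c' + curConst 4 L * b' ^ 2) < α := by simpa only [Nat.cast_ofNat] using hc'α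
  have hAs' : 11 * (((4 : ℕ) : ℝ)) ^ 2 * α ≤ 1 / 6 := by simpa only [Nat.cast_ofNat] using hAs
  have hAc' : α + 11 * (((4 : ℕ) : ℝ)) ^ 2 * α ≤ c₁ := by simpa only [Nat.cast_ofNat] using hAc
  have hMcα' : (Mc + 1) * (b' + 226 * (8 * ((4 : ℕ) + 1 : ℝ) * ((4 : ℕ) + 4 : ℝ)) ^ 2 * b' ^ 2) ≤ 1 / 2 := by simpa using hMcα
  have hC335' : 2 * (Mc + 1) * (b' + 226 * (8 * ((4 : ℕ) + 1 : ℝ) * ((4 : ℕ) + 4 : ℝ)) ^ 2 * b' ^ 2) + 2 * Mc * (2 * (c' + curConst 4 L * b' ^ 2)) +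
      4 * Mc * (1 + 2 * Mc) * (b' + 226 * (8 * ((4 : ℕ) + 1 : ℝ) * ((4 : ℕ) + 4 : ℝ)) ^ 2 * b' ^ 2) ^ 2 < C335 := by simpa using hC335
  -- (T4ᵀ_print) at the pairs (§1), then the dictionaries (file 11 §3), then THE END (file 9 §3)
  have hOutP := thm4OutputPrint_of_thm4TorusAt_print (d := 4) (b := b) (g := g) (by norm_num) hL hε.le hb' hc' hb'1 hRb' hb'α' hc'α' hα hεα hA3 hA2 hAs' hAc'
    hMc hMcα' h𝒬 hC335' hT4 h3
  have hss' : B * (α + 11 * (((4 : ℕ) : ℝ)) ^ 2 * α) ≤ s₁ := by simpa only [Nat.cast_ofNat] using hss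
  have hgrad' : B * (α + 11 * (((4 : ℕ) : ℝ)) ^ 2 * α) + 2 * (b' + 226 * (8 * ((4 : ℝ) + 1) * ((4 : ℝ) + 4)) ^ 2 * b' ^ 2) * s₁ ≤ s₁ := by
    simpa only [Nat.cast_ofNat] using hgrad
  have hℓ' : B * (α + 11 * (((4 : ℕ) : ℝ)) ^ 2 * α) +
      4 * ((4 : ℕ) : ℝ) * (b' + 226 * (8 * (((4 : ℕ) : ℝ) + 1) * (((4 : ℕ) : ℝ) + 4)) ^ 2 * b' ^ 2) * (B * (α + 11 * (((4 : ℕ) : ℝ)) ^ 2 * α)) ≤ s₁ := by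
    push_cast at hℓ ⊢; linarith only [hℓ]
  have hhol' : Bh * (α + 11 * (((4 : ℕ) : ℝ)) ^ 2 * α) +
      8 * (b' + 226 * (8 * (((4 : ℕ) : ℝ) + 1) * (((4 : ℕ) : ℝ) + 4)) ^ 2 * b' ^ 2) * (B * (α + 11 * (((4 : ℕ) : ℝ)) ^ 2 * α)) ≤ s₂ := by
    push_cast at hhol ⊢; linarith only [hhol]
  exact hC hb' hc' hRb hcF hb'α₁ hε hεr hs₁ hs₁r hb hbh hgrad' s₂ β
    (thm4OutputLandau138_of_thm4OutputPrint hL hb' hbs' hβ hss' hhol' hℓ' hOutP h3) h3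

end

end Summit.QuantumFields.YangMills.BalabanUVNodes.N16HolderOfThm4Output
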